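import Literature.AnabelianGeometry.AbsoluteAnabelian.AbsTopIThm26iii
import Literature.AnabelianGeometry.AbsoluteAnabelian.AbsTopII.Remark332Proofs
import HarnessLib

/-!
# [AbsTopI] Thm 2.6 (v): `Θ` is normal; `Θ = {1}` and `ζ̃(Π) = ζ(Π)` when `θ²(Π) = Primes`

Proof-only companion (no definitions, no named facts) of abc-iut-L4-t4's statements file
`AbsTopIThm26iii.lean` ([AbsTopI] Thm 2.6 (iii) and the general form of (v); S. Mochizuki, *Topics in
Absolute Anabelian Geometry I* (2012), manuscript p. 22, lit key `paper:url-11ac98ba15fc`):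

  "(v) [...] If `θ²(Π) ≠ Primes`, then write `Θ ⊆ Π` for the maximal almost pro-omissive [...]
   closed normal subgroup of `Π` [...]; if `θ²(Π) = Primes`, or there does not exist a unique such
   maximal subgroup, set `Θ := {1} ⊆ Π`. Then `ζ̃(Π) := ζ(Π/Θ) = [k : ℚ_p]`".

Sanity / bridge lemmas for the typed `thetaSubgroup`, `zetaTildeInv`, `Thm26vFull`: `Θ` is normal and
equals its normal core (by which the quotient was formed); in the case `θ²(Π) = Primes` one has
`Θ = {1}` and `ζ̃(Π) = ζ(Π)` (transport of `ζ` along `Π/{1} ≅ Π`, abc-iut-L4-t6's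
`zetaInv_eq_of_continuousMulEquiv`), so the first clause of the general
form `Thm26vFull` is then literally the first clause `ζ(Π) = [k : ℚ_p]` of the special case `Thm26v`
typed in `AbsTopISemiAbsolute.lean`.  HONEST FRAMING: refereed, undisputed material; nothing here
bears on [IUTchIII] Cor. 3.12.
-/

noncomputable section

open Topology

namespace Literature.AnabelianGeometry.AbsoluteAnabelian

universe u

section Theta

variable (G : Type u) [Group G] [TopologicalSpace G] [IsTopologicalGroup G]

/-- `Θ ⊆ Π` is a normal subgroup: it is either the chosen maximal NORMAL subgroup or `{1}`.
[cite: MochizukiAbsTopI2012, Thm 2.6 (v) p.22] -/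
theorem thetaSubgroup_normal : (thetaSubgroup G).Normal := by
  unfold thetaSubgroup
  split_ifs with h
  · exact (Classical.choose_spec h.2).1.1.1
  · infer_instance

/-- Hence `Θ` equals its normal core (the subgroup by which `ζ̃(Π) := ζ(Π/Θ)` is formed in
`zetaTildeInv`). [cite: MochizukiAbsTopI2012, Thm 2.6 (v) p.22] -/
theorem normalCore_thetaSubgroup : (thetaSubgroup G).normalCore = thetaSubgroup G :=
  letI := thetaSubgroup_normal G
  Subgroup.normalCore_eq_self _

/-- "if `θ²(Π) = Primes` [...] set `Θ := {1}`". [cite: MochizukiAbsTopI2012, Thm 2.6 (v) p.22] -/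
theorem thetaSubgroup_eq_bot_of_thetaSet_two_eq (h : thetaSet G 2 = {l | l.Prime}) :
    thetaSubgroup G = ⊥ := by
  unfold thetaSubgroup
  rw [dif_neg]
  exact fun h' => h'.1 h

/-- When `Θ` is the chosen maximal subgroup (`θ²(Π) ≠ Primes` and a unique maximal almost pro-omissive
topologically finitely generated closed normal subgroup exists), it IS such a maximal subgroup.
[cite: MochizukiAbsTopI2012, Thm 2.6 (v) p.22] -/
theorem isMaximalAPONormal_thetaSubgroup (h : thetaSet G 2 ≠ {l | l.Prime})
    (hu : ∃! N : Subgroup G, IsMaximalAPONormal G N) : IsMaximalAPONormal G (thetaSubgroup G) := by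
  unfold thetaSubgroup
  rw [dif_pos ⟨h, hu⟩]
  exact (Classical.choose_spec hu).1

end Theta

section Zeta

variable {G : Type u} [Group G] [TopologicalSpace G]

variable (G) in
/-- The quotient of a topological group by a normal subgroup EQUAL to `{1}` is bicontinuously
isomorphic to the group. [folklore] -/
private theorem nonempty_continuousMulEquiv_quotient_of_eq_bot [IsTopologicalGroup G]
    (N : Subgroup G) [N.Normal] (hN : N = ⊥) : Nonempty (G ⧸ N ≃ₜ* G) := by
  subst hN
  refine ⟨{ QuotientGroup.quotientBot with
    continuous_toFun := ?_
    continuous_invFun := ?_ }⟩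
  · -- the lift of `id` along the open quotient map `G → G/{1}`
    change Continuous (QuotientGroup.quotientBot : G ⧸ (⊥ : Subgroup G) → G)
    rw [← QuotientGroup.isOpenQuotientMap_mk.continuous_comp_iff]
    have : (QuotientGroup.quotientBot : G ⧸ (⊥ : Subgroup G) → G) ∘ QuotientGroup.mk = id := by
      funext x
      rfl
    rw [this]
    exact continuous_id
  · change Continuous (fun g : G => (QuotientGroup.quotientBot.symm g : G ⧸ (⊥ : Subgroup G)))
    exact QuotientGroup.continuous_mk

variable (G) in
/-- "if `θ²(Π) = Primes` [...] `Θ := {1}`. Then `ζ̃(Π) := ζ(Π/Θ)`" is `ζ(Π)`: the case in which the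
general form of Thm 2.6 (v) (`Thm26vFull`) reduces to the typed special case (`Thm26v`, `Θ = {1}`).
[cite: MochizukiAbsTopI2012, Thm 2.6 (v) p.22] -/
theorem zetaTildeInv_eq_zetaInv_of_thetaSet_two_eq [IsTopologicalGroup G]
    (h : thetaSet G 2 = {l | l.Prime}) : zetaTildeInv G = zetaInv G := by
  have hb : (thetaSubgroup G).normalCore = ⊥ := by
    rw [normalCore_thetaSubgroup, thetaSubgroup_eq_bot_of_thetaSet_two_eq G h]
  obtain ⟨e⟩ := nonempty_continuousMulEquiv_quotient_of_eq_bot G (thetaSubgroup G).normalCore hb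
  unfold zetaTildeInv
  exact zetaInv_eq_of_continuousMulEquiv e

end Zeta

namespace FundamentalExtension

/-- In the case `θ²(Π) = Primes` the first clause "`ζ̃(Π) = [k : ℚ_p]`" of the general form of
[AbsTopI] Thm 2.6 (v) (`Thm26vFull`) is the first clause "`ζ(Π) = [k : ℚ_p]`" of the special case
`Thm26v` (`Θ = {1}`) typed in `AbsTopISemiAbsolute.lean`. [cite: MochizukiAbsTopI2012, Thm 2.6 (v) p.22] -/
theorem thm26vFull_fst_iff_of_thetaSet_two_eq (E : FundamentalExtension.{u}) (B : E.MLFBase)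
    (h : thetaSet E.arith 2 = {l | l.Prime}) :
    zetaTildeInv E.arith = (Module.finrank ℚ_[B.p] B.K : ℕ) ↔
      zetaInv E.arith = (Module.finrank ℚ_[B.p] B.K : ℕ) := by
  rw [zetaTildeInv_eq_zetaInv_of_thetaSet_two_eq E.arith h]

end FundamentalExtension

end Literature.AnabelianGeometry.AbsoluteAnabelian
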